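import Mathlib
import HarnessLib
import Summits.Ventures.LatticeQCDFlow.TrivializingMaps.AcceptanceFootprintCurveGauge
import Summits.Ventures.LatticeQCDFlow.TrivializingMaps.AcceptanceCurveFull

/-!
# THEOREM Q♯♯ — the exact acceptance–footprint curve `4 acc (1 - acc)` on the WHOLE range `acc ≥ ½`,
# density, range and lattice-gauge forms (row 96e)

Honest framing: exact (Metropolis-corrected) sampling algorithms for lattice gauge theory; figures
of merit are autocorrelation/cost numbers at stated couplings and volumes; no continuum-physics
claim.

`AcceptanceFootprintCurve` (row 95b) proved `|Cov_π(A,B)| ≤ max(8/9, 4 acc (1 - acc)) · a b` for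
`acc ≥ ½` by a stochastic rounding to `{±1}²` and the four-point algebra `sum_min_curve`, whose clause
(ii) carried the regime hypothesis `8/9 ≤ 4 |det x|`.  `AcceptanceCurveFull` (row 96d) removed that
hypothesis (`blockIneq`, discharging `AcceptanceCurveSwap.sum_min_curve_full_of_blockIneq`).  This
file re-runs the rounding of `curve_core` verbatim and reads off the curve WITHOUT the `max (8/9) ·`:

* `curve_core_full`, `curve_scaled_full` — density form, normalised / scaled;
* `abs_cov_le_curve_of_meanAccept` — **THEOREM Q♯♯**: in the setting of THEOREM Q
  (`AcceptanceFootprint.abs_cov_le_of_meanAccept`: reference measure `μ`, target density `p`, model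
  density `q`, equilibrium mean acceptance of the independence sampler `≥ acc`, bounded measurable
  witnesses `|A| ≤ a`, `|B| ≤ b`, `a, b > 0`, uncorrelated under the model), for `acc ≥ ½`:
  `|Cov_π(A, B)| ≤ 4 acc (1 - acc) · a b`.  With `AcceptanceFootprintFloor` (the corner family attains
  it for every `acc ∈ [½, 1]`) the sharp footprint function is `g♯(acc) = 4 acc (1 - acc)` on the
  whole of `[½, 1]`; equivalently the ACCEPTANCE CEILING `acc ≤ (1 + √(1 - |Cov|/(ab)))/2`;
* `abs_cov_le_curve_of_meanAccept_of_range`, `sep_le_two_mul_range_of_meanAccept_curve` — range form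
  (push-forward proposals of range `r` on link fields, witnesses more than `2r` apart);
* `Gauge.abs_cov_boltzmann_le_curve_of_meanAccept`, `Gauge.sep_le_two_mul_range_of_meanAccept_curve`
  — the instance `π = 𝒵⁻¹ e^{-S} D[U]` on `SU(n)` link fields, any continuous action, any coupling,
  any volume.

NOT CLAIMED: anything about smooth / perturbative trivializing maps (Lüscher's statements stay cited
facts), cost, autocorrelation, or the continuum; degenerate witnesses `a = 0` or `b = 0` are excluded
by hypothesis as in row 95b.  No `sorry`, no new axioms, no `def`.

References: M. Lüscher, CMP 293 (2010) 899–919, arXiv:0907.5491 [Luscher2010Trivializing] (context).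
-/

namespace Summit.Ventures.LatticeQCDFlow.TrivializingMaps.Curve

open MeasureTheory Set
open scoped ENNReal NNReal

/-! ## §1. Density form -/

section Full

variable {X : Type*} [MeasurableSpace X] {μ : Measure X} {p q : X → ℝ}
variable [SFinite μ]

/-- **THE FULL CURVE — normalised core** (`|A|, |B| ≤ 1`, integrals against the reference measure
`μ`).  With `Cov = ∫ p A B - (∫ p A)(∫ p B)`, `A`, `B` uncorrelated under `q·μ`, and `acc ≥ ½`:
`(2 acc - 1)² ≤ 1 - |Cov|`.  (The rounding of `curve_core`, closed by
`sum_min_curve_full_of_blockIneq blockIneq`.) -/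
theorem curve_core_full (hp0 : ∀ x, 0 ≤ p x) (hpm : Measurable p) (hpi : Integrable p μ)
    (hp1 : ∫ x, p x ∂μ = 1) (hq0 : ∀ x, 0 ≤ q x) (hqm : Measurable q) (hqi : Integrable q μ)
    (hq1 : ∫ x, q x ∂μ = 1) {acc : ℝ}
    (hacc : acc ≤ ∫ x, ∫ y, min (p x * q y) (p y * q x) ∂μ ∂μ) (hacc2 : 1 / 2 ≤ acc)
    {A B : X → ℝ} (hAm : Measurable A) (hBm : Measurable B) (hA : ∀ x, |A x| ≤ 1)
    (hB : ∀ x, |B x| ≤ 1)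
    (hfac : ∫ x, q x * (A x * B x) ∂μ = (∫ x, q x * A x ∂μ) * ∫ x, q x * B x ∂μ) :
    (2 * acc - 1) ^ 2
      ≤ 1 - |∫ x, p x * (A x * B x) ∂μ - (∫ x, p x * A x ∂μ) * ∫ x, p x * B x ∂μ| := by
  set α := ∫ x, p x * A x ∂μ with hαd
  set β := ∫ x, p x * B x ∂μ with hβd
  set γ := ∫ x, p x * (A x * B x) ∂μ with hγd
  set α' := ∫ x, q x * A x ∂μ with hα'd
  set β' := ∫ x, q x * B x ∂μ with hβ'd
  -- spins, rounding weights (randomised rounding of `(A, B)` to `{±1}²`)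
  let sg : Bool → ℝ := fun b => if b then 1 else -1
  let κ : Bool × Bool → X → ℝ := fun z u => (1 + sg z.1 * A u) * (1 + sg z.2 * B u) / 4
  have hsg : ∀ b, sg b = 1 ∨ sg b = -1 := fun b => by cases b <;> simp [sg]
  have hfA : ∀ b u, 0 ≤ 1 + sg b * A u ∧ 1 + sg b * A u ≤ 2 := fun b u => by
    have := abs_le.1 (hA u); rcases hsg b with h | h <;> rw [h] <;> constructor <;> linarith
  have hfB : ∀ b u, 0 ≤ 1 + sg b * B u ∧ 1 + sg b * B u ≤ 2 := fun b u => by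
    have := abs_le.1 (hB u); rcases hsg b with h | h <;> rw [h] <;> constructor <;> linarith
  have hκm : ∀ z, Measurable (κ z) := fun z =>
    ((measurable_const.add (measurable_const.mul hAm)).mul
      (measurable_const.add (measurable_const.mul hBm))).div_const 4
  have hκ0 : ∀ z u, 0 ≤ κ z u := fun z u =>
    div_nonneg (mul_nonneg (hfA z.1 u).1 (hfB z.2 u).1) (by norm_num)
  have hκ1 : ∀ z u, κ z u ≤ 1 := fun z u => by
    have h := mul_le_mul (hfA z.1 u).2 (hfB z.2 u).2 (hfB z.2 u).1 (by norm_num : (0:ℝ) ≤ 2)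
    show (1 + sg z.1 * A u) * (1 + sg z.2 * B u) / 4 ≤ 1
    linarith
  have hκs : ∀ u, ∑ z, κ z u = 1 := fun u => by
    simp only [κ, sg, Fintype.sum_prod_type, Fintype.sum_bool, if_true, if_false, Bool.false_eq_true]
    ring
  -- the rounded cell masses, in closed form
  let x : Bool × Bool → ℝ := fun z => (1 + sg z.1 * α + sg z.2 * β + sg z.1 * sg z.2 * γ) / 4
  set p' := (1 + α') / 2 with hp'd
  set q' := (1 + β') / 2 with hq'd
  let y : Bool × Bool → ℝ := fun z => (if z.1 then p' else 1 - p') * (if z.2 then q' else 1 - q')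
  have hx : ∀ z, x z = ∫ u, p u * κ z u ∂μ := fun z => by
    show _ = ∫ u, p u * ((1 + sg z.1 * A u) * (1 + sg z.2 * B u) / 4) ∂μ
    rw [integral_density_round hpm hpi hAm hBm hA hB, hp1]
  have hy : ∀ z, y z = ∫ u, q u * κ z u ∂μ := fun z => by
    show _ = ∫ u, q u * ((1 + sg z.1 * A u) * (1 + sg z.2 * B u) / 4) ∂μ
    rw [integral_density_round hqm hqi hAm hBm hA hB, hq1, hfac]
    rcases z with ⟨b₁, b₂⟩
    cases b₁ <;> cases b₂ <;>
      simp only [y, sg, hp'd, hq'd, if_true, if_false, Bool.false_eq_true] <;> ring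
  have hred := meanAccept_le_sum_min hp0 hpm hpi hq0 hqm hqi hq1 κ hκm hκ0 hκ1 hκs hx hy
  -- hypotheses of the four-point lemmas
  have hx0 : ∀ z, 0 ≤ x z := fun z => by
    rw [hx z]; exact integral_nonneg fun u => mul_nonneg (hp0 u) (hκ0 z u)
  have hxs : x (true, true) + x (true, false) + x (false, true) + x (false, false) = 1 := by
    simp only [x, sg, if_true, if_false, Bool.false_eq_true]; ring
  have hα' := abs_le.1 (abs_integral_density_mul_le hq0 hqm hqi hq1 hAm hA)
  have hβ' := abs_le.1 (abs_integral_density_mul_le hq0 hqm hqi hq1 hBm hB)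
  have hp'0 : 0 ≤ p' := by rw [hp'd]; linarith [hα'.1]
  have hp'1 : p' ≤ 1 := by rw [hp'd]; linarith [hα'.2]
  have hq'0 : 0 ≤ q' := by rw [hq'd]; linarith [hβ'.1]
  have hq'1 : q' ≤ 1 := by rw [hq'd]; linarith [hβ'.2]
  have hcov : x (true, true) * x (false, false) - x (true, false) * x (false, true)
      = (γ - α * β) / 4 := by
    simp only [x, sg, if_true, if_false, Bool.false_eq_true]; ring
  have key : 4 * |x (true, true) * x (false, false) - x (true, false) * x (false, true)|
      = |γ - α * β| := by
    rw [hcov, abs_div, abs_of_pos (by norm_num : (0:ℝ) < 4)]; ring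
  -- the four-point algebra WITHOUT regime hypothesis (`AcceptanceCurveFull.blockIneq` discharging
  -- the hypothesis of `AcceptanceCurveSwap.sum_min_curve_full_of_blockIneq`)
  have hc := sum_min_curve_full_of_blockIneq blockIneq x hx0 hxs hp'0 hp'1 hq'0 hq'1
    (hacc.trans hred) hacc2
  rw [key] at hc
  exact hc

/-- **THE FULL CURVE — scaled `μ`-form** (`|A| ≤ a`, `|B| ≤ b`, `a, b > 0`, `acc ≥ ½`):
`|Cov| ≤ 4 acc (1 - acc) a b`. -/
theorem curve_scaled_full (hp0 : ∀ x, 0 ≤ p x) (hpm : Measurable p) (hpi : Integrable p μ)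
    (hp1 : ∫ x, p x ∂μ = 1) (hq0 : ∀ x, 0 ≤ q x) (hqm : Measurable q) (hqi : Integrable q μ)
    (hq1 : ∫ x, q x ∂μ = 1) {acc : ℝ}
    (hacc : acc ≤ ∫ x, ∫ y, min (p x * q y) (p y * q x) ∂μ ∂μ) (hacc2 : 1 / 2 ≤ acc)
    {A B : X → ℝ} (hAm : Measurable A) (hBm : Measurable B) {a b : ℝ} (ha : 0 < a) (hb : 0 < b)
    (hA : ∀ x, |A x| ≤ a) (hB : ∀ x, |B x| ≤ b)
    (hfac : ∫ x, q x * (A x * B x) ∂μ = (∫ x, q x * A x ∂μ) * ∫ x, q x * B x ∂μ) :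
    |∫ x, p x * (A x * B x) ∂μ - (∫ x, p x * A x ∂μ) * ∫ x, p x * B x ∂μ|
      ≤ 4 * acc * (1 - acc) * (a * b) := by
  have hab : 0 < a * b := mul_pos ha hb
  have hA' : ∀ x, |A x / a| ≤ 1 := fun x => by
    rw [abs_div, abs_of_pos ha]; exact (div_le_one ha).2 (hA x)
  have hB' : ∀ x, |B x / b| ≤ 1 := fun x => by
    rw [abs_div, abs_of_pos hb]; exact (div_le_one hb).2 (hB x)
  have e1 : ∀ r : X → ℝ, ∫ x, r x * (A x / a * (B x / b)) ∂μ
      = (∫ x, r x * (A x * B x) ∂μ) / (a * b) := fun r => by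
    rw [← integral_div]
    exact integral_congr_ae (Filter.Eventually.of_forall fun x => by ring)
  have e2 : ∀ r : X → ℝ, ∫ x, r x * (A x / a) ∂μ = (∫ x, r x * A x ∂μ) / a := fun r => by
    rw [← integral_div]
    exact integral_congr_ae (Filter.Eventually.of_forall fun x => by ring)
  have e3 : ∀ r : X → ℝ, ∫ x, r x * (B x / b) ∂μ = (∫ x, r x * B x ∂μ) / b := fun r => by
    rw [← integral_div]
    exact integral_congr_ae (Filter.Eventually.of_forall fun x => by ring)
  have hfac' : ∫ x, q x * (A x / a * (B x / b)) ∂μ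
      = (∫ x, q x * (A x / a) ∂μ) * ∫ x, q x * (B x / b) ∂μ := by
    rw [e1, e2, e3, hfac]; field_simp
  have hcore := curve_core_full hp0 hpm hpi hp1 hq0 hqm hqi hq1 hacc hacc2 (hAm.div_const a)
    (hBm.div_const b) hA' hB' hfac'
  rw [e1, e2, e3] at hcore
  set C := ∫ x, p x * (A x * B x) ∂μ - (∫ x, p x * A x ∂μ) * ∫ x, p x * B x ∂μ with hC
  have hcov : (∫ x, p x * (A x * B x) ∂μ) / (a * b)
      - (∫ x, p x * A x ∂μ) / a * ((∫ x, p x * B x ∂μ) / b) = C / (a * b) := by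
    rw [hC]; field_simp
  rw [hcov, abs_div, abs_of_pos hab] at hcore
  have h3 : |C| / (a * b) ≤ 4 * acc * (1 - acc) := by nlinarith
  rwa [div_le_iff₀ hab] at h3

/-- **THEOREM Q♯♯ — THE EXACT CURVE ON THE WHOLE RANGE.**  Hypotheses of THEOREM Q
(`abs_cov_le_of_meanAccept`), `a, b > 0`, `acc ≥ ½`:  `|Cov_π(A, B)| ≤ 4 acc (1 - acc) · a b`
— attained for every `acc ∈ [½, 1]` by the corner family of `AcceptanceFootprintFloor`, so the
sharp footprint function `g♯(acc)` EQUALS `4 acc (1 - acc)` on `[½, 1]` (it is `1` on `[0, ½]`). -/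
theorem abs_cov_le_curve_of_meanAccept (hp0 : ∀ x, 0 ≤ p x) (hpm : Measurable p)
    (hpi : Integrable p μ) (hp1 : ∫ x, p x ∂μ = 1) (hq0 : ∀ x, 0 ≤ q x) (hqm : Measurable q)
    (hqi : Integrable q μ) (hq1 : ∫ x, q x ∂μ = 1) {acc : ℝ}
    (hacc : acc ≤ ∫ x, ∫ y, min (p x * q y) (p y * q x) ∂μ ∂μ) (hacc2 : 1 / 2 ≤ acc) {A B : X → ℝ}
    (hAm : Measurable A) (hBm : Measurable B) {a b : ℝ} (ha : 0 < a) (hb : 0 < b)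
    (hA : ∀ x, |A x| ≤ a) (hB : ∀ x, |B x| ≤ b)
    (hfac : ∫ x, A x * B x ∂(μ.withDensity fun x => ENNReal.ofReal (q x))
      = (∫ x, A x ∂(μ.withDensity fun x => ENNReal.ofReal (q x)))
        * ∫ x, B x ∂(μ.withDensity fun x => ENNReal.ofReal (q x))) :
    |∫ x, A x * B x ∂(μ.withDensity fun x => ENNReal.ofReal (p x))
        - (∫ x, A x ∂(μ.withDensity fun x => ENNReal.ofReal (p x)))
          * ∫ x, B x ∂(μ.withDensity fun x => ENNReal.ofReal (p x))|
      ≤ 4 * acc * (1 - acc) * (a * b) := by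
  simp only [integral_withDensity_ofReal_eq hp0 hpm, integral_withDensity_ofReal_eq hq0 hqm] at hfac ⊢
  exact curve_scaled_full hp0 hpm hpi hp1 hq0 hqm hqi hq1 hacc hacc2 hAm hBm ha hb hA hB hfac

/-- **THE ACCEPTANCE CEILING ALONG THE CURVE.**  Same hypotheses: a decorrelated witness pair with
`m · a b ≤ |Cov_π(A, B)|` forces `(2 acc - 1)² ≤ 1 - m`, i.e. `acc ≤ (1 + √(1 - m))/2`
(`m = 1`: the ceiling `½` of row 95b; `m → 0`: no constraint). -/
theorem meanAccept_ceiling_of_abs_cov_ge (hp0 : ∀ x, 0 ≤ p x) (hpm : Measurable p)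
    (hpi : Integrable p μ) (hp1 : ∫ x, p x ∂μ = 1) (hq0 : ∀ x, 0 ≤ q x) (hqm : Measurable q)
    (hqi : Integrable q μ) (hq1 : ∫ x, q x ∂μ = 1) {acc : ℝ}
    (hacc : acc ≤ ∫ x, ∫ y, min (p x * q y) (p y * q x) ∂μ ∂μ) (hacc2 : 1 / 2 ≤ acc) {A B : X → ℝ}
    (hAm : Measurable A) (hBm : Measurable B) {a b : ℝ} (ha : 0 < a) (hb : 0 < b)
    (hA : ∀ x, |A x| ≤ a) (hB : ∀ x, |B x| ≤ b)
    (hfac : ∫ x, A x * B x ∂(μ.withDensity fun x => ENNReal.ofReal (q x))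
      = (∫ x, A x ∂(μ.withDensity fun x => ENNReal.ofReal (q x)))
        * ∫ x, B x ∂(μ.withDensity fun x => ENNReal.ofReal (q x))) {m : ℝ}
    (hm : m * (a * b) ≤ |∫ x, A x * B x ∂(μ.withDensity fun x => ENNReal.ofReal (p x))
        - (∫ x, A x ∂(μ.withDensity fun x => ENNReal.ofReal (p x)))
          * ∫ x, B x ∂(μ.withDensity fun x => ENNReal.ofReal (p x))|) :
    (2 * acc - 1) ^ 2 ≤ 1 - m := by
  have h := hm.trans (abs_cov_le_curve_of_meanAccept hp0 hpm hpi hp1 hq0 hqm hqi hq1 hacc hacc2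
    hAm hBm ha hb hA hB hfac)
  have hab : 0 < a * b := mul_pos ha hb
  have h' : m ≤ 4 * acc * (1 - acc) := le_of_mul_le_mul_right (by linarith) hab
  nlinarith

end Full

/-! ## §2. Range form: push-forward proposals of range `r` on link fields -/

section Range

variable {ι : Type*} [Fintype ι] {α : Type*} [MeasurableSpace α]
variable (μ₀ : Measure α) [IsProbabilityMeasure μ₀]

/-- **THEOREM Q♯♯, range form.**  Link fields `ι → α` with i.i.d. reference law `μ₀^ι`; target
`π = p · μ₀^ι`; model law the push-forward `Φ_* μ₀^ι` of a measurable map of RANGE `r` with density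
`q`; equilibrium acceptance `≥ acc ≥ ½`.  Every pair of measurable observables `|A| ≤ a`, `|B| ≤ b`
(`0 < a`, `0 < b`) supported MORE THAN `2 r` apart has
`|∫ A B ∂π - (∫ A ∂π)(∫ B ∂π)| ≤ 4 acc (1 - acc) · a b`. -/
theorem abs_cov_le_curve_of_meanAccept_of_range {p q : (ι → α) → ℝ} (hp0 : ∀ x, 0 ≤ p x)
    (hpm : Measurable p) (hpi : Integrable p (Measure.pi fun _ : ι => μ₀))
    (hp1 : ∫ x, p x ∂(Measure.pi fun _ : ι => μ₀) = 1) (hq0 : ∀ x, 0 ≤ q x) (hqm : Measurable q)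
    (hqi : Integrable q (Measure.pi fun _ : ι => μ₀))
    (hq1 : ∫ x, q x ∂(Measure.pi fun _ : ι => μ₀) = 1)
    (d : ι → ι → ℕ) (hsymm : ∀ a b, d a b = d b a) (htri : ∀ a b c, d a c ≤ d a b + d b c)
    {Φ : (ι → α) → (ι → α)} (hΦm : Measurable Φ)
    (hν : (Measure.pi fun _ : ι => μ₀).map Φ
      = (Measure.pi fun _ : ι => μ₀).withDensity fun x => ENNReal.ofReal (q x))
    {N : ι → Set ι} (hΦ : ∀ i, DependsOn (fun W => Φ W i) (N i)) {r : ℕ}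
    (hN : ∀ i, ∀ j ∈ N i, d i j ≤ r) {acc : ℝ}
    (hacc : acc ≤ ∫ x, ∫ y, min (p x * q y) (p y * q x) ∂(Measure.pi fun _ : ι => μ₀)
      ∂(Measure.pi fun _ : ι => μ₀)) (hacc2 : 1 / 2 ≤ acc)
    {A B : (ι → α) → ℝ} (hAm : Measurable A) (hBm : Measurable B) {a b : ℝ} (ha : 0 < a)
    (hb : 0 < b) (hAa : ∀ x, |A x| ≤ a) (hBb : ∀ x, |B x| ≤ b) {S T : Set ι} (hA : DependsOn A S)
    (hB : DependsOn B T)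
    (hsep : ∀ i ∈ S, ∀ j ∈ T, 2 * r < d i j) :
    |∫ U, A U * B U ∂((Measure.pi fun _ : ι => μ₀).withDensity fun x => ENNReal.ofReal (p x))
        - (∫ U, A U ∂((Measure.pi fun _ : ι => μ₀).withDensity fun x => ENNReal.ofReal (p x)))
          * ∫ U, B U ∂((Measure.pi fun _ : ι => μ₀).withDensity fun x => ENNReal.ofReal (p x))|
      ≤ 4 * acc * (1 - acc) * (a * b) := by
  have hfac := pushforward_integral_mul_eq_of_range μ₀ d hsymm htri hΦm hΦ hN hAm hBm hA hB hsep
  rw [hν] at hfac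
  exact abs_cov_le_curve_of_meanAccept hp0 hpm hpi hp1 hq0 hqm hqi hq1 hacc hacc2 hAm hBm ha hb
    hAa hBb hfac

/-- **FOOTPRINT LAW ON THE FULL CURVE, range form.**  Same setting, `½ ≤ acc`: a witness pair at
separation `≥ sep` with connected correlation `≥ m > 4 acc (1 - acc) · a b` under the target forces
`sep ≤ 2 r`. -/
theorem sep_le_two_mul_range_of_meanAccept_curve {p q : (ι → α) → ℝ} (hp0 : ∀ x, 0 ≤ p x)
    (hpm : Measurable p) (hpi : Integrable p (Measure.pi fun _ : ι => μ₀))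
    (hp1 : ∫ x, p x ∂(Measure.pi fun _ : ι => μ₀) = 1) (hq0 : ∀ x, 0 ≤ q x) (hqm : Measurable q)
    (hqi : Integrable q (Measure.pi fun _ : ι => μ₀))
    (hq1 : ∫ x, q x ∂(Measure.pi fun _ : ι => μ₀) = 1)
    (d : ι → ι → ℕ) (hsymm : ∀ a b, d a b = d b a) (htri : ∀ a b c, d a c ≤ d a b + d b c)
    {Φ : (ι → α) → (ι → α)} (hΦm : Measurable Φ)
    (hν : (Measure.pi fun _ : ι => μ₀).map Φ
      = (Measure.pi fun _ : ι => μ₀).withDensity fun x => ENNReal.ofReal (q x))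
    {N : ι → Set ι} (hΦ : ∀ i, DependsOn (fun W => Φ W i) (N i)) {r : ℕ}
    (hN : ∀ i, ∀ j ∈ N i, d i j ≤ r) {acc : ℝ}
    (hacc : acc ≤ ∫ x, ∫ y, min (p x * q y) (p y * q x) ∂(Measure.pi fun _ : ι => μ₀)
      ∂(Measure.pi fun _ : ι => μ₀)) (hacc2 : 1 / 2 ≤ acc)
    {A B : (ι → α) → ℝ} (hAm : Measurable A) (hBm : Measurable B) {a b : ℝ} (ha : 0 < a)
    (hb : 0 < b) (hAa : ∀ x, |A x| ≤ a) (hBb : ∀ x, |B x| ≤ b) {S T : Set ι} (hA : DependsOn A S)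
    (hB : DependsOn B T)
    {sep : ℕ} (hfar : ∀ i ∈ S, ∀ j ∈ T, sep ≤ d i j) {m : ℝ}
    (hm : m ≤ |∫ U, A U * B U ∂((Measure.pi fun _ : ι => μ₀).withDensity fun x => ENNReal.ofReal (p x))
        - (∫ U, A U ∂((Measure.pi fun _ : ι => μ₀).withDensity fun x => ENNReal.ofReal (p x)))
          * ∫ U, B U ∂((Measure.pi fun _ : ι => μ₀).withDensity fun x => ENNReal.ofReal (p x))|)
    (hacc_m : 4 * acc * (1 - acc) * (a * b) < m) : sep ≤ 2 * r := by
  by_contra hcon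
  have hsep : ∀ i ∈ S, ∀ j ∈ T, 2 * r < d i j :=
    fun i hi j hj => lt_of_lt_of_le (not_le.1 hcon) (hfar i hi j hj)
  exact absurd (hm.trans (abs_cov_le_curve_of_meanAccept_of_range μ₀ hp0 hpm hpi hp1 hq0 hqm hqi
    hq1 d hsymm htri hΦm hν hΦ hN hacc hacc2 hAm hBm ha hb hAa hBb hA hB hsep)) (not_le.2 hacc_m)

end Range

/-! ## §3. The lattice gauge instance: `π = 𝒵⁻¹ e^{-S} D[U]` on `SU(n)` link fields -/

namespace Gauge

open Literature.MathematicalPhysics.QuantumFieldTheory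
open Literature.MathematicalPhysics.QuantumFieldTheory.Luscher2010

variable {d L n : ℕ} [NeZero L]

/-- **THEOREM Q♯♯ for lattice gauge theory — the exact curve on the whole range.**  `G = SU(n)`,
continuous action `S`, target `π = 𝒵⁻¹ e^{-S} D[U]`; a measurable proposal map `Φ` of RANGE `r`
whose push-forward `Φ_* D[V]` has density `q ≥ 0` against `D[U]`; the independence sampler on it
(exact for `π`) has equilibrium acceptance `≥ acc ≥ ½`.  Then for all measurable `|A| ≤ a`, `|B| ≤ b`
(`0 < a`, `0 < b`) on link sets more than `2 r` apart:  `|⟨A B⟩ - ⟨A⟩⟨B⟩| ≤ 4 acc (1 - acc) · a b`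
(expectations in `π`), at every coupling and in every volume. -/
theorem abs_cov_boltzmann_le_curve_of_meanAccept
    {S : GaugeConfig d L (Matrix.specialUnitaryGroup (Fin n) ℂ) → ℝ} (hS : Continuous S)
    (dist : Edge d L → Edge d L → ℕ) (hsymm : ∀ e e', dist e e' = dist e' e)
    (htri : ∀ e e' e'', dist e e'' ≤ dist e e' + dist e' e'')
    {Φ : GaugeConfig d L (Matrix.specialUnitaryGroup (Fin n) ℂ) →
      GaugeConfig d L (Matrix.specialUnitaryGroup (Fin n) ℂ)} (hΦm : Measurable Φ)
    {q : GaugeConfig d L (Matrix.specialUnitaryGroup (Fin n) ℂ) → ℝ} (hq0 : ∀ U, 0 ≤ q U)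
    (hqm : Measurable q)
    (hν : (trivialMeasure (Matrix.specialUnitaryGroup (Fin n) ℂ) d L).map Φ
      = (trivialMeasure (Matrix.specialUnitaryGroup (Fin n) ℂ) d L).withDensity
          fun U => ENNReal.ofReal (q U))
    {N : Edge d L → Set (Edge d L)} (hΦ : ∀ e, DependsOn (fun W => Φ W e) (N e)) {r : ℕ}
    (hN : ∀ e, ∀ e' ∈ N e, dist e e' ≤ r) {acc : ℝ}
    (hacc : acc ≤ ∫ U, ∫ U', min (Real.exp (-S U) / (partitionFn S).toReal * q U')
        (Real.exp (-S U') / (partitionFn S).toReal * q U)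
        ∂(trivialMeasure (Matrix.specialUnitaryGroup (Fin n) ℂ) d L)
        ∂(trivialMeasure (Matrix.specialUnitaryGroup (Fin n) ℂ) d L)) (hacc2 : 1 / 2 ≤ acc)
    {A B : GaugeConfig d L (Matrix.specialUnitaryGroup (Fin n) ℂ) → ℝ} (hAm : Measurable A)
    (hBm : Measurable B) {a b : ℝ} (ha : 0 < a) (hb : 0 < b) (hAa : ∀ U, |A U| ≤ a)
    (hBb : ∀ U, |B U| ≤ b) {SA SB : Set (Edge d L)} (hA : DependsOn A SA) (hB : DependsOn B SB)
    (hsep : ∀ e ∈ SA, ∀ e' ∈ SB, 2 * r < dist e e') :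
    |∫ U, A U * B U ∂(boltzmannMeasure S)
        - (∫ U, A U ∂(boltzmannMeasure S)) * ∫ U, B U ∂(boltzmannMeasure S)|
      ≤ 4 * acc * (1 - acc) * (a * b) := by
  obtain ⟨hp0, hpm, hpi, hp1⟩ := Gauge.density_boltzmann_spec (d := d) (L := L) hS
  obtain ⟨hqi, hq1⟩ := Gauge.integrable_of_map_eq_withDensity (d := d) (L := L) hΦm hq0 hqm hν
  rw [Gauge.boltzmannMeasure_eq_withDensity hS]
  unfold trivialMeasure at hpi hp1 hqi hq1 hν hacc ⊢
  exact abs_cov_le_curve_of_meanAccept_of_range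
    (haarProbability (Matrix.specialUnitaryGroup (Fin n) ℂ)) hp0 hpm hpi hp1 hq0 hqm hqi hq1 dist
    hsymm htri hΦm hν hΦ hN hacc hacc2 hAm hBm ha hb hAa hBb hA hB hsep

/-- **FOOTPRINT LAW ON THE FULL CURVE for lattice gauge theory.**  Same setting, `½ ≤ acc`; a
witness pair at separation `≥ sep` with connected correlation `≥ m > 4 acc (1 - acc) · a b` under
`𝒵⁻¹ e^{-S} D[U]` forces `sep ≤ 2 r`: a range-`r` exact proposal with acceptance `acc` cannot exist
unless every such pair sits within `2 r`. -/
theorem sep_le_two_mul_range_of_meanAccept_curve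
    {S : GaugeConfig d L (Matrix.specialUnitaryGroup (Fin n) ℂ) → ℝ} (hS : Continuous S)
    (dist : Edge d L → Edge d L → ℕ) (hsymm : ∀ e e', dist e e' = dist e' e)
    (htri : ∀ e e' e'', dist e e'' ≤ dist e e' + dist e' e'')
    {Φ : GaugeConfig d L (Matrix.specialUnitaryGroup (Fin n) ℂ) →
      GaugeConfig d L (Matrix.specialUnitaryGroup (Fin n) ℂ)} (hΦm : Measurable Φ)
    {q : GaugeConfig d L (Matrix.specialUnitaryGroup (Fin n) ℂ) → ℝ} (hq0 : ∀ U, 0 ≤ q U)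
    (hqm : Measurable q)
    (hν : (trivialMeasure (Matrix.specialUnitaryGroup (Fin n) ℂ) d L).map Φ
      = (trivialMeasure (Matrix.specialUnitaryGroup (Fin n) ℂ) d L).withDensity
          fun U => ENNReal.ofReal (q U))
    {N : Edge d L → Set (Edge d L)} (hΦ : ∀ e, DependsOn (fun W => Φ W e) (N e)) {r : ℕ}
    (hN : ∀ e, ∀ e' ∈ N e, dist e e' ≤ r) {acc : ℝ}
    (hacc : acc ≤ ∫ U, ∫ U', min (Real.exp (-S U) / (partitionFn S).toReal * q U')
        (Real.exp (-S U') / (partitionFn S).toReal * q U)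
        ∂(trivialMeasure (Matrix.specialUnitaryGroup (Fin n) ℂ) d L)
        ∂(trivialMeasure (Matrix.specialUnitaryGroup (Fin n) ℂ) d L)) (hacc2 : 1 / 2 ≤ acc)
    {A B : GaugeConfig d L (Matrix.specialUnitaryGroup (Fin n) ℂ) → ℝ} (hAm : Measurable A)
    (hBm : Measurable B) {a b : ℝ} (ha : 0 < a) (hb : 0 < b) (hAa : ∀ U, |A U| ≤ a)
    (hBb : ∀ U, |B U| ≤ b) {SA SB : Set (Edge d L)} (hA : DependsOn A SA) (hB : DependsOn B SB)
    {sep : ℕ} (hfar : ∀ e ∈ SA, ∀ e' ∈ SB, sep ≤ dist e e') {m : ℝ}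
    (hm : m ≤ |∫ U, A U * B U ∂(boltzmannMeasure S)
        - (∫ U, A U ∂(boltzmannMeasure S)) * ∫ U, B U ∂(boltzmannMeasure S)|)
    (hacc_m : 4 * acc * (1 - acc) * (a * b) < m) : sep ≤ 2 * r := by
  by_contra hcon
  have hsep : ∀ e ∈ SA, ∀ e' ∈ SB, 2 * r < dist e e' :=
    fun e he e' he' => lt_of_lt_of_le (not_le.1 hcon) (hfar e he e' he')
  exact absurd (hm.trans (abs_cov_boltzmann_le_curve_of_meanAccept hS dist hsymm htri hΦm hq0 hqm hν
    hΦ hN hacc hacc2 hAm hBm ha hb hAa hBb hA hB hsep)) (not_le.2 hacc_m)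

end Gauge

end Summit.Ventures.LatticeQCDFlow.TrivializingMaps.Curve
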